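import Literature.AnabelianGeometry.EtaleTheta.Discharge.Sec4NonVacuityThm44
import Literature.AnabelianGeometry.EtaleTheta.Discharge.Sec4Model
import Literature.AnabelianGeometry.EtaleTheta.Discharge.Sec4Prop43ii
import Literature.AnabelianGeometry.EtaleTheta.Discharge.Sec4Thm44
import HarnessLib

/-!
# [EtTh] §4: Prop 4.2 (i)(ii), Prop 4.3 (ii)(iii) and Thm 4.4 (iv) FIRE at the toy setting
# (consistency witness, part 3 — the remaining §4 closers)

S. Mochizuki, *The étale theta function and its Frobenioid-theoretic manifestations*, Publ. RIMS **45**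
(2009) [MochizukiEtTh2009], §4, Prop 4.2 (i)(ii) p.88 (PDF), Prop 4.3 (ii)(iii) pp.90–91, Thm 4.4 (iv) p.94.

CONSISTENCY WITNESS, TOY — joint satisfiability of the §4 hypothesis packages; consistency ≠ faithfulness
(abc-iut-L2-lead 02:26:58Z).  Sequel of `Discharge/Sec4NonVacuity.lean` (p418516: the perfect toy tempered
Frobenioid, `Toy.biKummerSetting` through `mkOfModelCanonical`) and `Discharge/Sec4NonVacuityThm44.lean`
(p418792: the toy is a Frobenioid; the identity `Thm44Hyp`; (i)(ii)(iii) fire).  Here the REMAINING typed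
§4 conclusions are obtained at that ONE explicit setting by running the cell's landed closers on inputs
that hold there:

* `Toy.prop42_i`, `Toy.prop42_ii` — `Prop42_i`, `Prop42_ii` (abc-iut-L6-t12's `prop42_i_mkOfModel`,
  `prop42_ii_mkOfModel`; their [FrdI] Prop 4.1 (iii) cancellation law `hDS` is PROVED here for the
  canonical coprimality predicate on `Φ = ℚ_{≥0}` — a totally ordered sharp monoid: "coprime" means "one of
  the two is `0`");
* `Toy.prop43_ii`, `Toy.prop43_iii` — `Prop43_ii pullFracModel` (this seat's gen-0 `prop43_ii_of`) and
  `Prop43_iii pullFracModel` (abc-iut-L6-t12's `prop43_iii_mkOfModel`), modulo nothing;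
* `Toy.thm44_iv_id` — `Thm44_iv` for the identity `Thm44Hyp` and `ψ = id` (abc-iut-L2-t3's
  `thm44_iv_of_prop43_ii` ∘ `Toy.prop43_ii`);
* `Toy.sec4_typed_conclusions` — the conjunction: at one explicit inhabitant of `BiKummerSetting` the typed
  statements Prop42_i ∧ Prop42_ii ∧ Prop43_ii ∧ Prop43_iii ∧ Thm44_i ∧ Thm44_ii ∧ Thm44_iii ∧ Thm44_iv
  hold SIMULTANEOUSLY — so the typed §4 statement set is consistent with the setting and every landed §4
  closer has a satisfiable hypothesis list.  (Prop42_iii/iv are NOT claimed: the toy has no coverings,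
  so `N`-th roots of non-`N`-th powers do not exist there — that is the content of ERRATUM E2.)

HONEST LIMITS as in parts 1–2 (one-object base, trivial [FrdI] vocabularies, `(N,H)`-slot `True`; not a
curve).  Proof-only: no definition, no named fact, no instance, no `sorry`.  Nothing here bears on, or takes
a side on, [IUTchIII] Cor. 3.12.
-/

noncomputable section

namespace Literature.AnabelianGeometry.EtaleTheta

open CategoryTheory Opposite Literature.AlgebraicGeometry.Frobenioids
open scoped NNRat

namespace Toy

/-! ## The [FrdI] Prop 4.1 (iii) cancellation law for coprimality in `ℚ_{≥0}` -/

/-- In the submonoid `⊤ ⊆ ℚ_{≥0}` (written multiplicatively), `x ∣ y` iff `x ≤ y`. [folklore] -/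
private theorem dvd_iff_le (x y : (⊤ : Submonoid (Multiplicative ℚ≥0))) :
    x ∣ y ↔ Multiplicative.toAdd x.1 ≤ Multiplicative.toAdd y.1 := by
  constructor
  · rintro ⟨c, hc⟩
    have h : Multiplicative.toAdd y.1 = Multiplicative.toAdd x.1 + Multiplicative.toAdd c.1 := by
      rw [← toAdd_mul]; exact congrArg (fun z => Multiplicative.toAdd z.1) hc
    rw [h]
    exact le_self_add
  · intro h
    obtain ⟨d, hd⟩ := exists_add_of_le h
    refine ⟨⟨Multiplicative.ofAdd d, trivial⟩, Subtype.ext ?_⟩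
    change y.1 = x.1 * Multiplicative.ofAdd d
    apply Multiplicative.toAdd.injective
    rw [toAdd_mul, toAdd_ofAdd, hd]

/-- Coprimality ("every common divisor is trivial") in `ℚ_{≥0}` means: one of the two elements is `0`
(`ℚ_{≥0}` is totally ordered). [folklore] -/
private theorem coprime_iff (a b : (⊤ : Submonoid (Multiplicative ℚ≥0))) :
    (∀ x : (⊤ : Submonoid (Multiplicative ℚ≥0)), x ∣ a → x ∣ b → x = 1) ↔ a = 1 ∨ b = 1 := by
  constructor
  · intro h
    rcases le_total (Multiplicative.toAdd a.1) (Multiplicative.toAdd b.1) with hab | hba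
    · exact Or.inl (h a (dvd_refl a) ((dvd_iff_le a b).2 hab))
    · exact Or.inr (h b ((dvd_iff_le b a).2 hba) (dvd_refl b))
  · rintro (rfl | rfl) x hxa hxb
    · exact le_antisymm (le_of_dvd_one' hxa) (one_le' x)
    · exact le_antisymm (le_of_dvd_one' hxb) (one_le' x)
where
  /-- `x ∣ 1 ⇒ x ≤ 1` in the ordered sense used above. -/
  le_of_dvd_one' {x : (⊤ : Submonoid (Multiplicative ℚ≥0))} (hx : x ∣ 1) : x ≤ 1 := by
    have h := (dvd_iff_le x 1).1 hx
    exact h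
  /-- `1 ≤ x`. -/
  one_le' (x : (⊤ : Submonoid (Multiplicative ℚ≥0))) : 1 ≤ x := by
    show Multiplicative.toAdd (1 : Multiplicative ℚ≥0) ≤ Multiplicative.toAdd x.1
    rw [toAdd_one]
    exact zero_le

/-! ## The §4 closers fire at the toy -/

/-- Automorphism groups in the one-object discrete base category are trivial. [folklore] -/
private theorem subsingleton_aut'' (A : Discrete PUnit.{1}) : Subsingleton (Aut A) :=
  ⟨fun _ _ => Iso.ext (Subsingleton.elim _ _)⟩

/-- The cancellation law `hDS` of abc-iut-L6-t12's `prop42_i/ii_mkOfModel` ([FrdI] Prop 4.1 (iii): two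
coprime pairs with the same "fraction" coincide) for the canonical coprimality predicate on `Φ = ℚ_{≥0}`.
[cite: MochizukiFrdI2008, Prop. 4.1 (iii) p.77] -/
theorem coprime_cancel {a b a' b' : (⊤ : Submonoid (Multiplicative ℚ≥0))}
    (h : ∀ x : (⊤ : Submonoid (Multiplicative ℚ≥0)), x ∣ a → x ∣ b → x = 1)
    (h' : ∀ x : (⊤ : Submonoid (Multiplicative ℚ≥0)), x ∣ a' → x ∣ b' → x = 1) (e : a * b' = a' * b) :
    a = a' ∧ b = b' := by
  have hc := (coprime_iff a b).1 h
  have hc' := (coprime_iff a' b').1 h'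
  have he : Multiplicative.toAdd a.1 + Multiplicative.toAdd b'.1 =
      Multiplicative.toAdd a'.1 + Multiplicative.toAdd b.1 := by
    rw [← toAdd_mul, ← toAdd_mul]
    exact congrArg (fun z : (⊤ : Submonoid (Multiplicative ℚ≥0)) => Multiplicative.toAdd z.1) e
  have h1 : ∀ z : (⊤ : Submonoid (Multiplicative ℚ≥0)), z = 1 ↔ Multiplicative.toAdd z.1 = 0 := by
    intro z
    rw [← toAdd_one]
    exact ⟨fun hz => by rw [hz]; rfl,
      fun hz => Subtype.ext (Multiplicative.toAdd.injective (hz.trans (toAdd_one).symm))⟩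
  have key : Multiplicative.toAdd a.1 = Multiplicative.toAdd a'.1 ∧
      Multiplicative.toAdd b.1 = Multiplicative.toAdd b'.1 := by
    rcases hc with ha | hb <;> rcases hc' with ha' | hb'
    · rw [(h1 a).1 ha, (h1 a').1 ha'] at he ⊢
      exact ⟨rfl, by simpa using he.symm⟩
    · rw [(h1 a).1 ha, (h1 b').1 hb'] at he
      have h0 : Multiplicative.toAdd a'.1 = 0 ∧ Multiplicative.toAdd b.1 = 0 := by
        simpa using he.symm
      rw [(h1 a).1 ha, (h1 b').1 hb', h0.1, h0.2]
      exact ⟨rfl, rfl⟩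
    · rw [(h1 b).1 hb, (h1 a').1 ha'] at he
      have h0 : Multiplicative.toAdd a.1 = 0 ∧ Multiplicative.toAdd b'.1 = 0 := by simpa using he
      rw [(h1 b).1 hb, (h1 a').1 ha', h0.1, h0.2]
      exact ⟨rfl, rfl⟩
    · rw [(h1 b).1 hb, (h1 b').1 hb'] at he ⊢
      exact ⟨by simpa using he, rfl⟩
  exact ⟨Subtype.ext (Multiplicative.toAdd.injective key.1), Subtype.ext (Multiplicative.toAdd.injective key.2)⟩

/-- In the one-object base, pull-back along any (iso)morphism preserves coprimality (the pull-back is the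
identity). [cite: MochizukiFrdI2008, Prop. 4.1 (iii) p.77] -/
theorem coprime_pull {A A' : Discrete PUnit.{1}} (e : A' ⟶ A)
    {a b : temperedFrobenioidQ.Φ.carrier (op A)}
    (h : ∀ x : temperedFrobenioidQ.Φ.carrier (op A), x ∣ a → x ∣ b → x = 1) :
    ∀ y : temperedFrobenioidQ.Φ.carrier (op A'),
      y ∣ pull temperedFrobenioidQ.divisorMonoid e a → y ∣ pull temperedFrobenioidQ.divisorMonoid e b →
        y = 1 := by
  obtain ⟨⟨⟩⟩ := A
  obtain ⟨⟨⟩⟩ := A'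
  obtain rfl : e = 𝟙 _ := Subsingleton.elim _ _
  have hid : pull temperedFrobenioidQ.divisorMonoid (𝟙 (⟨PUnit.unit⟩ : Discrete PUnit.{1})) =
      MonoidHom.id _ := by
    ext x
    change (temperedFrobenioidQ.divisorMonoid.map (𝟙 _).op).hom x = x
    rw [op_id, temperedFrobenioidQ.divisorMonoid.map_id]
    rfl
  rw [hid]
  exact h

/-- **Prop 4.2 (i) HOLDS at the toy** (abc-iut-L6-t12's `prop42_i_mkOfModel`, with `hDS := coprime_cancel`).
[cite: MochizukiEtTh2009, Prop 4.2 p.88] -/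
theorem prop42_i : biKummerSetting.Prop42_i :=
  BiKummerSetting.prop42_i_mkOfModel temperedGroup temperedFrobenioidQ temperedFrobenioidQ_monoidType
    temperedFrobenioidQ_isPerfect realifiedQ.isUnit_BΛ
    (fun {A} a b => ∀ x : temperedFrobenioidQ.Φ.carrier A, x ∣ a → x ∣ b → x = 1) (fun _ => True)
    (fun _ _ => 1) (fun A _ _ => ⟨1, (subsingleton_aut'' A).elim _ _⟩) (fun _ _ _ => True)
    (fun {_ _} G α₂ α₁ => temperedFrobenioidQ.ArisesFromBaseFrobeniusPair G α₂ α₁) Aodot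
    isFrobeniusTrivial_Aodot trivial divisorMonoidQ_isDivisorial
    (fun h h' e => coprime_cancel h h' e)

/-- **Prop 4.2 (ii) HOLDS at the toy** (`prop42_ii_mkOfModel`, `hDS := coprime_cancel`,
`hDSι := coprime_pull`). [cite: MochizukiEtTh2009, Prop 4.2 p.88] -/
theorem prop42_ii : biKummerSetting.Prop42_ii :=
  BiKummerSetting.prop42_ii_mkOfModel temperedGroup temperedFrobenioidQ temperedFrobenioidQ_monoidType
    temperedFrobenioidQ_isPerfect realifiedQ.isUnit_BΛ
    (fun {A} a b => ∀ x : temperedFrobenioidQ.Φ.carrier A, x ∣ a → x ∣ b → x = 1) (fun _ => True)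
    (fun _ _ => 1) (fun A _ _ => ⟨1, (subsingleton_aut'' A).elim _ _⟩) (fun _ _ _ => True)
    (fun {_ _} G α₂ α₁ => temperedFrobenioidQ.ArisesFromBaseFrobeniusPair G α₂ α₁) Aodot
    isFrobeniusTrivial_Aodot trivial divisorMonoidQ_isDivisorial
    (fun h h' e => coprime_cancel h h' e) (fun e _ _ _ h => coprime_pull e h)

/-- **Prop 4.3 (ii) HOLDS at the toy** for the genuine transport `pullFracModel` (this seat's gen-0 closer
`prop43_ii_of`, `Φ` divisorial, `B` group-like). [cite: MochizukiEtTh2009, Prop 4.3 p.90] -/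
theorem prop43_ii :
    biKummerSetting.Prop43_ii fun {_ _} φ => temperedFrobenioidQ.pullFracModel φ :=
  biKummerSetting.prop43_ii_of divisorMonoidQ_isDivisorial ratFnFunctorQ_isGroupLike
    (fun {_ _} φ => temperedFrobenioidQ.pullFracModel φ)

/-- **Prop 4.3 (iii) HOLDS at the toy** for `pullFracModel` (abc-iut-L6-t12's `prop43_iii_mkOfModel`).
[cite: MochizukiEtTh2009, Prop 4.3 p.91] -/
theorem prop43_iii :
    biKummerSetting.Prop43_iii fun {_ _} φ => temperedFrobenioidQ.pullFracModel φ :=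
  BiKummerSetting.prop43_iii_mkOfModel temperedGroup temperedFrobenioidQ temperedFrobenioidQ_monoidType
    temperedFrobenioidQ_isPerfect realifiedQ.isUnit_BΛ
    (fun {A} a b => ∀ x : temperedFrobenioidQ.Φ.carrier A, x ∣ a → x ∣ b → x = 1) (fun _ => True)
    (fun _ _ => 1) (fun A _ _ => ⟨1, (subsingleton_aut'' A).elim _ _⟩) (fun _ _ _ => True)
    (fun {_ _} G α₂ α₁ => temperedFrobenioidQ.ArisesFromBaseFrobeniusPair G α₂ α₁) Aodot
    isFrobeniusTrivial_Aodot trivial divisorMonoidQ_isDivisorial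
    (fun {_ _} φ => temperedFrobenioidQ.pullFracModel φ)

/-- **Thm 4.4 (iv) FIRES at the toy** for the identity `Thm44Hyp`, `ψ = id`, `pullFrac₁ = pullFrac₂ =
pullFracModel` (abc-iut-L2-t3's `thm44_iv_of_prop43_ii` ∘ `prop43_ii`). [cite: MochizukiEtTh2009, Thm 4.4 p.94] -/
theorem thm44_iv_id :
    BiKummerSetting.Thm44_iv thm44HypId (fun _ => MulEquiv.refl _)
      (fun {_ _} φ => temperedFrobenioidQ.pullFracModel φ) (fun {_ _} φ => temperedFrobenioidQ.pullFracModel φ) :=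
  BiKummerSetting.thm44_iv_of_prop43_ii thm44HypId (fun _ => MulEquiv.refl _)
    (fun {_ _} φ => temperedFrobenioidQ.pullFracModel φ) (fun {_ _} φ => temperedFrobenioidQ.pullFracModel φ)
    prop43_ii

/-- **The typed §4 statement set holds simultaneously at one explicit setting**: Prop 4.2 (i)(ii),
Prop 4.3 (ii)(iii), Thm 4.4 (i)(ii)(iii)(iv) at `Toy.biKummerSetting` / the identity `Thm44Hyp` — obtained by
running the cell's landed closers; hence those closers' hypothesis lists are jointly satisfiable and the
typed statements are mutually consistent with the §4 setting. (Prop 4.2 (iii)(iv): not claimed — the toy has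
no coverings.) [cite: MochizukiEtTh2009, Thm 4.4 p.94] -/
theorem sec4_typed_conclusions :
    biKummerSetting.Prop42_i ∧ biKummerSetting.Prop42_ii ∧
      (biKummerSetting.Prop43_ii fun {_ _} φ => temperedFrobenioidQ.pullFracModel φ) ∧
      (biKummerSetting.Prop43_iii fun {_ _} φ => temperedFrobenioidQ.pullFracModel φ) ∧
      BiKummerSetting.Thm44_i thm44HypId ∧
      BiKummerSetting.Thm44_ii thm44HypId (fun _ => MulEquiv.refl _) ∧
      BiKummerSetting.Thm44_iii thm44HypId (fun _ => MulEquiv.refl _) ∧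
      BiKummerSetting.Thm44_iv thm44HypId (fun _ => MulEquiv.refl _)
        (fun {_ _} φ => temperedFrobenioidQ.pullFracModel φ) (fun {_ _} φ => temperedFrobenioidQ.pullFracModel φ) :=
  ⟨prop42_i, prop42_ii, prop43_ii, prop43_iii, thm44_i_id, thm44_ii_id, thm44_iii_id, thm44_iv_id⟩

end Toy

end Literature.AnabelianGeometry.EtaleTheta

end
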